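import Mathlib.Topology.Algebra.InfiniteSum.Constructions
import Mathlib.Analysis.Normed.Group.InfiniteSum
import Mathlib.Analysis.Complex.Basic
import Mathlib.Topology.ContinuousMap.Compact
import Mathlib.Topology.Sets.Compacts
import HarnessLib

/-!
# R90-TF · S6 «Ch. 14.1–5 stable trace formula» — WAVE 2, W2-c: HECKE-DISCRETE functionals on a compact chart are closed
# under `ℂ`-linear combinations

Cell `hodgecm-mathlib`, crux H413 (`stmt-HodgeConjecture-24833`), route of record `HCCMUnconditional`; programme R90-TF (brief
`director/R90-BRIEF.v2.md` 1f40d54518340a35), section S6 = Ch. 14.1–5 (base `R90-C14`), seat R90-C14-p01 (g0), target W2-c of the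
section planner's sheet `R90/R90-C14-plan/g0/S6_wave2_targets.v1.R90-C14-plan-g0.lean` (sha16 ea7d8b634ac71f5c, :13–:17, signature
VERBATIM, namespace without the sheet's `.Wave2`).  Helper file, lane `--supports stmt-HodgeConjecture-24833`; ONE theorem, no definition,
no instance, no notation, no `sorry`; pure Mathlib (Theorems may not import Lines files, so the body of FILE B's text `HeckeDiscrete`
— `Cruxes/H413/Lines/R90_S6_StableTFSpectralB.lean` — is EXPANDED here token-for-token: «`F φ = Σ_j c_j · ev φ (z_j)` with
`Σ ‖c_j‖ < ∞`», no injectivity of `z`).  HONEST LABEL: HC_CM is proved only modulo the 7 printed citations (2 remaining named inputs: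
hLiu418 = stmt-HodgeConjecture-24832, h413 = stmt-HodgeConjecture-24833) until rung 0 closes; this file is elementary analysis and
proves no printed global statement.

WHY (print).  In the comparison of [Rogawski1990 §14.5 p. 241] (vanishing of the right-hand side of (14.5.1), by «the argument of
comparison of measures used in the proof of Theorem 10.3.1», §10.3 p. 159) the DISCRETE side is not produced in one piece: the
supplier delivers `θ_{G′}(f′)` ((2.3.1) p. 17) and `Sθ_G(f) + ½ Sθ_H(f^H)` separately, each «a discrete sum of the form (10.3.6)
`Σ c_j f̂_w(z_j)` … absolutely convergent» on the compact `t`-chart `X ⊂ ℂ` of p. 159, and the dichotomy text of the S6 socket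
(`sock_S6_langlandsDichotomy`, ★ W1-d) is applied to their signed `½`-COMBINATION.  This file is that bookkeeping step: a linear
combination `a·F + b·G` of two functionals of the discrete shape is again of the discrete shape — index `ι₁ ⊕ ι₂`, points
`Sum.elim z₁ z₂`, weights `Sum.elim (a·c₁) (b·c₂)`; absolute summability on a `Sum` type is `Summable.sum`, the value is
`HasSum.sum` of the two scaled series (each summable because `‖c_j · ev φ (z_j)‖ ≤ ‖c_j‖ · ‖ev φ‖_∞` on the compact chart).

## References
* [Rogawski1990] J. D. Rogawski, *Automorphic Representations of Unitary Groups in Three Variables*, Ann. of Math. Stud. 123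
  (1990): §10.3 p. 159 (proof of Thm. 10.3.1, the sums (10.3.6)); §14.5 p. 241 (vanishing of the right-hand side of (14.5.1));
  §2.3 (2.3.1) p. 17.
-/

set_option autoImplicit false
-- the mandated namespace repeats the single-problem summit's segment (`HodgeConjecture.HodgeConjecture`)
set_option linter.dupNamespace false

noncomputable section

open Topology

namespace Summit.HodgeConjecture.HodgeConjecture.R90.S6

/-- **W2-c · Hecke-discrete functionals are a `ℂ`-linear family** [Rogawski1990 §10.3 p. 159, sums (10.3.6); §14.5 p. 241]:
on a compact chart `X ⊂ ℂ` with test family `ev : Φ → C(X, ℂ)`, if `F φ = Σ_j c₁ j · ev φ (z₁ j)` and `G φ = Σ_j c₂ j · ev φ (z₂ j)`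
with `Σ ‖c₁ j‖, Σ ‖c₂ j‖ < ∞`, then `a·F φ + b·G φ = Σ_j c j · ev φ (z j)` for the family indexed by `ι₁ ⊕ ι₂` with
`z = Sum.elim z₁ z₂`, `c = Sum.elim (a·c₁) (b·c₂)`, again absolutely summable.  (Signature verbatim from the S6 WAVE 2 sheet, W2-c:
the EXPANDED body of FILE B's `HeckeDiscrete`, no injectivity of `z`.) -/
theorem heckeDiscrete_linear (X : TopologicalSpace.Compacts ℂ) {Φ : Type} (ev : Φ → C(X, ℂ)) (F G : Φ → ℂ) (a b : ℂ)
    (hF : ∃ (ι : Type) (z : ι → X) (c : ι → ℂ), Summable (fun j => ‖c j‖) ∧ ∀ φ, F φ = ∑' j, c j * ev φ (z j))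
    (hG : ∃ (ι : Type) (z : ι → X) (c : ι → ℂ), Summable (fun j => ‖c j‖) ∧ ∀ φ, G φ = ∑' j, c j * ev φ (z j)) :
    ∃ (ι : Type) (z : ι → X) (c : ι → ℂ), Summable (fun j => ‖c j‖) ∧ ∀ φ, a * F φ + b * G φ = ∑' j, c j * ev φ (z j) := by
  obtain ⟨ι₁, z₁, c₁, hc₁, hF⟩ := hF
  obtain ⟨ι₂, z₂, c₂, hc₂, hG⟩ := hG
  -- each scaled series `Σ_j c j · ev φ (z j)` is absolutely summable: `‖c j · ev φ (z j)‖ ≤ ‖c j‖ · ‖ev φ‖_∞`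
  have hsm : ∀ {ι : Type} (z : ι → X) (c : ι → ℂ), Summable (fun j => ‖c j‖) →
      ∀ φ, Summable fun j => c j * ev φ (z j) := by
    intro ι z c hc φ
    refine Summable.of_norm_bounded (g := fun j => ‖c j‖ * ‖ev φ‖) (hc.mul_right _) fun j => ?_
    rw [norm_mul]
    exact mul_le_mul_of_nonneg_left ((ev φ).norm_coe_le_norm (z j)) (norm_nonneg _)
  refine ⟨ι₁ ⊕ ι₂, Sum.elim z₁ z₂, Sum.elim (fun j => a * c₁ j) (fun j => b * c₂ j), ?_, fun φ => ?_⟩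
  · -- absolute summability of the combined weights on the `Sum` type
    refine Summable.sum _ ?_ ?_
    · have h₁ : Summable fun j => ‖a‖ * ‖c₁ j‖ := hc₁.mul_left ‖a‖
      simpa only [Function.comp_def, Sum.elim_inl, norm_mul] using h₁
    · have h₂ : Summable fun j => ‖b‖ * ‖c₂ j‖ := hc₂.mul_left ‖b‖
      simpa only [Function.comp_def, Sum.elim_inr, norm_mul] using h₂
  · -- the value: `HasSum` on `ι₁ ⊕ ι₂` is the sum of the two `HasSum`s
    have h₁ : HasSum (fun j => a * c₁ j * ev φ (z₁ j)) (a * ∑' j, c₁ j * ev φ (z₁ j)) := by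
      simpa only [mul_assoc] using ((hsm z₁ c₁ hc₁ φ).hasSum.mul_left a)
    have h₂ : HasSum (fun j => b * c₂ j * ev φ (z₂ j)) (b * ∑' j, c₂ j * ev φ (z₂ j)) := by
      simpa only [mul_assoc] using ((hsm z₂ c₂ hc₂ φ).hasSum.mul_left b)
    have h : HasSum (fun i : ι₁ ⊕ ι₂ =>
        Sum.elim (fun j => a * c₁ j) (fun j => b * c₂ j) i * ev φ (Sum.elim z₁ z₂ i))
        (a * ∑' j, c₁ j * ev φ (z₁ j) + b * ∑' j, c₂ j * ev φ (z₂ j)) :=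
      HasSum.sum (f := fun i : ι₁ ⊕ ι₂ =>
        Sum.elim (fun j => a * c₁ j) (fun j => b * c₂ j) i * ev φ (Sum.elim z₁ z₂ i)) h₁ h₂
    rw [hF φ, hG φ]
    exact h.tsum_eq.symm

end Summit.HodgeConjecture.HodgeConjecture.R90.S6

end
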